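import Mathlib

/-!
# Hodge-locus census — the `b`-spectrum of the two-plane cells `(2k', d, k'-1)` in closed form (ENGINE B, gen 32, record §11)

Certified instances and evidence bearing on the general Hodge conjecture; no claim.

THEOREM SPEC-∞ of the record (= THEOREM SPEC-3, §9f/§9h, for `d ≥ 5` and THEOREM E2″, §10c, for
`d = 4`; paper proofs, lead-read) gives, for every `k' ≥ 3` and `d ≥ 4`, the exact set of values of
the jump `b(X)` over the smooth members of the cell `(2k', d, k'-1)`:
`{H_B(2), H_B(2) - C(k',2), 1, 0}` for `d ≥ 5` and `{C(k'+1,2), k', 2, 1, 0}` for `d = 4`, where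
`H_B(2) = C(k'+1, 2)`.  This file kernel-checks the arithmetic that makes the two descriptions one
formula (`H_B(2) - C(k',2) = k'`, so the `d = 4` set is the `d ≥ 5` set with the single extra value
`2`), that the extra value is genuinely new (`2 ∉` the `d ≥ 5` set when `k' ≥ 3`), and the
cardinalities `4` and `5` (all listed values are distinct for `k' ≥ 3`).  Nothing here formalises
the commutative algebra; it pins the integers and sets the paper proof produces.
-/

namespace Summit.HodgeConjecture.HodgeConjecture.HodgeLocus.Census.SpecInf

/-- `H_B(2) = C(k+1, 2)`: the number of quadrics in `k` variables (no relation of degree `2` when `d ≥ 4`). -/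
def hB2 (k : ℕ) : ℕ := (k + 1).choose 2

/-- The `b`-spectrum of `(2k, d, k-1)` for `d ≥ 5` (COROLLARY SPEC). -/
def specGe5 (k : ℕ) : Finset ℕ := {hB2 k, hB2 k - k.choose 2, 1, 0}

/-- The `b`-spectrum of `(2k, 4, k-1)` (COROLLARY E2-CENSUS). -/
def spec4 (k : ℕ) : Finset ℕ := {hB2 k, k, 2, 1, 0}

/-- The spectrum as one function of `(k, d)`, `d ≥ 4`. -/
def spec (k d : ℕ) : Finset ℕ := if d = 4 then spec4 k else specGe5 k

/-- Pascal: `C(k+1,2) = k + C(k,2)`. -/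
theorem hB2_eq (k : ℕ) : hB2 k = k + k.choose 2 := by
  unfold hB2
  have h : (k + 1).choose 2 = k.choose 1 + k.choose 2 := Nat.choose_succ_succ k 1
  rw [h, Nat.choose_one_right]

/-- The value attained when a linear form kills `δ`: `H_B(2) - C(k,2) = k` (the kernel is `ℓ·B_1`). -/
theorem hB2_sub_choose (k : ℕ) : hB2 k - k.choose 2 = k := by
  rw [hB2_eq]; omega

/-- `C(k,2) ≥ 3` for `k ≥ 3`. -/
theorem three_le_choose_two {k : ℕ} (hk : 3 ≤ k) : 3 ≤ k.choose 2 := by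
  have h := Nat.choose_le_choose 2 hk
  have h3 : Nat.choose 3 2 = 3 := by decide
  omega

/-- `H_B(2) ≥ k + 3` for `k ≥ 3`; in particular `H_B(2) > k > 2`. -/
theorem hB2_ge {k : ℕ} (hk : 3 ≤ k) : k + 3 ≤ hB2 k := by
  rw [hB2_eq]
  have := three_le_choose_two hk
  omega

/-- The `d = 4` spectrum is the `d ≥ 5` spectrum with the one extra value `2`. -/
theorem spec4_eq_insert (k : ℕ) : spec4 k = insert 2 (specGe5 k) := by
  ext b
  simp only [spec4, specGe5, hB2_sub_choose, Finset.mem_insert, Finset.mem_singleton]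
  tauto

/-- The extra value is genuinely new: `2` is not a `d ≥ 5` value when `k ≥ 3`. -/
theorem two_not_mem_specGe5 {k : ℕ} (hk : 3 ≤ k) : 2 ∉ specGe5 k := by
  have hH := hB2_ge hk
  simp only [specGe5, hB2_sub_choose, Finset.mem_insert, Finset.mem_singleton]
  omega

/-- Four distinct values for `d ≥ 5`, `k ≥ 3`. -/
theorem card_specGe5 {k : ℕ} (hk : 3 ≤ k) : (specGe5 k).card = 4 := by
  have hH := hB2_ge hk
  unfold specGe5
  rw [hB2_sub_choose]
  rw [Finset.card_insert_of_notMem, Finset.card_insert_of_notMem, Finset.card_insert_of_notMem,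
    Finset.card_singleton]
  · simp
  · simp only [Finset.mem_insert, Finset.mem_singleton]; omega
  · simp only [Finset.mem_insert, Finset.mem_singleton]; omega

/-- Five distinct values for `d = 4`, `k ≥ 3`. -/
theorem card_spec4 {k : ℕ} (hk : 3 ≤ k) : (spec4 k).card = 5 := by
  have hH := hB2_ge hk
  unfold spec4
  rw [Finset.card_insert_of_notMem, Finset.card_insert_of_notMem, Finset.card_insert_of_notMem,
    Finset.card_insert_of_notMem, Finset.card_singleton]
  · simp
  · simp
  · simp only [Finset.mem_insert, Finset.mem_singleton]; omega
  · simp only [Finset.mem_insert, Finset.mem_singleton]; omega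

/-- The spectrum never fills the interval `[0, H_B(2)]`: `H_B(2) - 1` is never a value (`k ≥ 3`, any `d ≥ 4`). -/
theorem pred_hB2_not_mem_spec {k d : ℕ} (hk : 3 ≤ k) : hB2 k - 1 ∉ spec k d := by
  have hH := hB2_ge hk
  unfold spec
  split_ifs
  · simp only [spec4, Finset.mem_insert, Finset.mem_singleton]; omega
  · simp only [specGe5, hB2_sub_choose, Finset.mem_insert, Finset.mem_singleton]; omega

/-- The instances quoted in the paper: `(6,d,2)`: `{6,3,1,0}`, `(8,d,3)`: `{10,4,1,0}` (`d ≥ 5`) and `(6,4,2)`: `{6,3,2,1,0}`. -/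
theorem spec_instances :
    specGe5 3 = {6, 3, 1, 0} ∧ specGe5 4 = {10, 4, 1, 0} ∧ spec4 3 = {6, 3, 2, 1, 0} := by
  refine ⟨?_, ?_, ?_⟩ <;> decide

end Summit.HodgeConjecture.HodgeConjecture.HodgeLocus.Census.SpecInf
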